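import Mathlib
import Summits.HodgeConjecture.HodgeConjecture.Theorems.PadicSemiregularLiftHodgeAbelianVarietiesAndrePowerHOne
import Literature.AlgebraicGeometry.HodgeTheory.WeilFamilyReachOfPeriodConstruction

/-!
# Crux `HodgeAbelianVarieties` (stmt-HodgeConjecture-1333), line `cm-pivot-andre` — André with CM targets, module L2a: the line basis of `H¹((A ⊗ O_E)(ℂ); ℂ)`

For the "extension of scalars" abelian variety `B = A ⊗ O_E`, realised as a biproduct `B ≅ A^n` with projections
`π i : B ⟶ A` and injections `ι i : A ⟶ B` (`work/andre/PLAN.md` §3), this module constructs the two commuting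
endomorphisms `X = diag ψ = Σ π_i ≫ ψ ≫ ι_i` and `Y = "θ" = Σ T_ij • (π_j ≫ ι_i)` (`T` the transposed companion
matrix of the integer minimal polynomial `X^n + Σ b_j X^j` of `θ`) and the JOINT EIGENBASIS
`𝔅(λ, s) = Σ_j ρ_s^j • π_j^* v_λ` of `H¹(B(ℂ); ℂ)` (`v` an eigenbasis of `ψ^*` on `H¹(A(ℂ); ℂ)`, `ρ_s` the conjugates
of `θ`): `X^* 𝔅(λ,s) = μ_λ 𝔅(λ,s)`, `Y^* 𝔅(λ,s) = ρ_s 𝔅(λ,s)`, `ι_0^* 𝔅(λ,s) = v_λ`, and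
`(Σ_i p_i π_i)^* v_λ = Σ_s 𝔅(λ,s)` for the integer power sums `p_i = Σ_s ρ_s^i`. Everything is formal from the
additivity of `f ↦ f^*` on `H¹` (tree, `complexBetti_map_add_one`) and the biproduct identities
(`bijective_sum_complexBetti_map_of_biproduct`, landed module W5).
-/

set_option linter.dupNamespace false

noncomputable section

namespace Summit.HodgeConjecture.HodgeConjecture.Theorems.HodgeAbelianVarieties.CMPivotAndre

open CategoryTheory
open Literature.AlgebraicGeometry Literature.AlgebraicGeometry.Motives Literature.AlgebraicGeometry.HodgeTheory

/-- **The line basis of `H¹(B(ℂ); ℂ)` for `B ≅ A^n` and the two commuting endomorphisms `diag ψ`, `θ`.**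
Given a biproduct presentation `(π, ι)` of `B` over `A` (`n ≥ 1`), an endomorphism `ψ` of `A` with an eigenbasis
`v` of `ψ^*` on `H¹(A(ℂ); ℂ)` (eigenvalues `μ`), pairwise distinct complex roots `ρ_s` of an integer monic
polynomial `X^n + Σ b_j X^j` and the integers `p_i = Σ_s ρ_s^i`, there are endomorphisms `X, Y` of `B` and a basis
`𝔅` of `H¹(B(ℂ); ℂ)` indexed by `Fin N × Fin n` with `𝔅(λ,s) = Σ_j ρ_s^j • π_j^* v_λ`, `X^* 𝔅(λ,s) = μ_λ 𝔅(λ,s)`,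
`Y^* 𝔅(λ,s) = ρ_s 𝔅(λ,s)`, `ι_0^* 𝔅(λ,s) = v_λ`, `(Σ_i p_i π_i)^* v_λ = Σ_s 𝔅(λ,s)`, and `X ≫ Y = Y ≫ X`
(`X = Σ_i π_i ≫ ψ ≫ ι_i`, `Y = Σ_{i,j} T_ij • (π_j ≫ ι_i)` with `T` the transposed companion matrix).
[cite: Andre1992HodgeCM, Théorème] [cite: LangeBirkenhake1992, §1.1 Prop. 1.1.6] -/
theorem exists_andreLineBasis : ∀ {N n : ℕ} (A B : Literature.AlgebraicGeometry.Motives.AbelianVariety ℂ) (π : Fin n → (B ⟶ A)) (ι : Fin n → (A ⟶ B)) (hn : 0 < n), (∀ i j : Fin n, ι i ≫ π j = if i = j then 𝟙 A else 0) → (∑ i, π i ≫ ι i = 𝟙 B) → ∀ (ψ : A ⟶ A) (μ : Fin N → ℂ) (v : Module.Basis (Fin N) ℂ (Literature.AlgebraicGeometry.HodgeTheory.complexBetti A.X 1)), (∀ l, Literature.AlgebraicGeometry.HodgeTheory.complexBetti.map ψ.hom.hom.hom 1 (v l) = μ l • v l) → ∀ (b : Fin n → ℤ) (ρ : Fin n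 → ℂ), Function.Injective ρ → (∀ s, ρ s ^ n + ∑ j, (b j : ℂ) * ρ s ^ (j : ℕ) = 0) → ∀ (p : ℕ → ℤ), (∀ i : ℕ, ∑ s, ρ s ^ i = (p i : ℂ)) → ∃ (X Y : B ⟶ B) (𝔅 : Module.Basis (Fin N × Fin n) ℂ (Literature.AlgebraicGeometry.HodgeTheory.complexBetti B.X 1)), (∀ l s, 𝔅 (l, s) = ∑ j : Fin n, ρ s ^ (j : ℕ) • Literature.AlgebraicGeometry.HodgeTheory.complexBetti.map (π j).hom.hom.hom 1 (v l)) ∧ (∀ l s, Literature.AlgebraicGeometry.HodgeTheory.complexBetti.map X.hom.hom.hom 1 (𝔅 (l, s)) = μ l • 𝔅 (l, s)) ∧ (∀ l s, Literature.AlgebraicGeometry.HodgeTheory.complexBetti.map Y.hom.hom.hom 1 (𝔅 (l, s)) = ρ s • 𝔅 (l, s)) ∧ (∀ l s, Literature.AlgebraicGeometry.HodgeTheory.complexBetti.map (ι ⟨0, hn⟩).hom.hom.hom 1 (𝔅 (l, s)) = v l) ∧ (∀ l, Literature.AlgebraicGeometry.HodgeTheory.complexBetti.map (∑ i : Fin n,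 p i • π i).hom.hom.hom 1 (v l) = ∑ s, 𝔅 (l, s)) ∧ X ≫ Y = Y ≫ X := by
  intro N n A B π ι hn hιπ htot ψ μ v hv b ρ hρ hfρ p hp
  classical
  haveI := finite_complexBetti_abelianVariety A 1
  haveI := finite_complexBetti_abelianVariety B 1
  obtain ⟨hbij, hcoord⟩ := bijective_sum_complexBetti_map_of_biproduct A B π ι hιπ htot
  -- notation for the pull-backs
  set P : Fin n → (complexBetti A.X 1 →ₗ[ℂ] complexBetti B.X 1) :=
    fun j => (complexBetti.map (π j).hom.hom.hom 1).hom with hP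
  have hPapp : ∀ j x, P j x = complexBetti.map (π j).hom.hom.hom 1 x := fun j x => rfl
  -- `Φ(c) = Σ_j π_j^* c_j` as a linear equivalence
  let Φ : (Fin n → complexBetti A.X 1) →ₗ[ℂ] complexBetti B.X 1 := ∑ j, (P j) ∘ₗ LinearMap.proj j
  have hΦ : ∀ c, Φ c = ∑ j, complexBetti.map (π j).hom.hom.hom 1 (c j) := by
    intro c
    simp only [Φ, LinearMap.coe_sum, Finset.sum_apply, LinearMap.coe_comp, Function.comp_apply,
      LinearMap.coe_proj, Function.eval, hPapp]
  have hΦbij : Function.Bijective Φ := by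
    have : (Φ : (Fin n → complexBetti A.X 1) → complexBetti B.X 1) =
        fun c => ∑ j, complexBetti.map (π j).hom.hom.hom 1 (c j) := funext hΦ
    rw [this]
    exact hbij
  let Φe : (Fin n → complexBetti A.X 1) ≃ₗ[ℂ] complexBetti B.X 1 := LinearEquiv.ofBijective Φ hΦbij
  have hΦe : ∀ c, Φe c = ∑ j, complexBetti.map (π j).hom.hom.hom 1 (c j) := fun c => hΦ c
  -- the family `𝔣(λ, s) = (ρ_s^j • v_λ)_j` is a basis of `Fin n → H¹(A)` (Vandermonde)
  let 𝔣 : Fin N × Fin n → (Fin n → complexBetti A.X 1) := fun ls j => ρ ls.2 ^ (j : ℕ) • v ls.1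
  have h𝔣li : LinearIndependent ℂ 𝔣 := by
    rw [Fintype.linearIndependent_iff]
    intro a ha
    have hj : ∀ j : Fin n, ∑ l : Fin N, (∑ s : Fin n, a (l, s) * ρ s ^ (j : ℕ)) • v l = 0 := by
      intro j
      have h0 := congrFun ha j
      rw [Finset.sum_apply, Pi.zero_apply, Fintype.sum_prod_type] at h0
      rw [← h0]
      refine Finset.sum_congr rfl fun l _ => ?_
      rw [Finset.sum_smul]
      refine Finset.sum_congr rfl fun s _ => ?_
      change _ = (a (l, s) • 𝔣 (l, s)) j
      rw [Pi.smul_apply]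
      change _ = a (l, s) • (ρ s ^ (j : ℕ) • v l)
      rw [smul_smul]
    have hcoef : ∀ (j : Fin n) (l : Fin N), ∑ s, a (l, s) * ρ s ^ (j : ℕ) = 0 := fun j l =>
      Fintype.linearIndependent_iff.mp v.linearIndependent _ (hj j) l
    have hdet : (Matrix.vandermonde ρ).det ≠ 0 := Matrix.det_vandermonde_ne_zero_iff.mpr hρ
    rintro ⟨l, s⟩
    have hvec : Matrix.vecMul (fun s => a (l, s)) (Matrix.vandermonde ρ) = 0 := by
      funext j
      rw [Matrix.vecMul, dotProduct, Pi.zero_apply, ← hcoef j l]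
      refine Finset.sum_congr rfl fun s _ => ?_
      rw [Matrix.vandermonde_apply]
    exact congrFun (Matrix.eq_zero_of_vecMul_eq_zero hdet hvec) s
  have hcard : Fintype.card (Fin N × Fin n) = Module.finrank ℂ (Fin n → complexBetti A.X 1) := by
    rw [Module.finrank_pi_fintype, Module.finrank_eq_card_basis v]
    simp [mul_comm]
  let 𝔣b : Module.Basis (Fin N × Fin n) ℂ (Fin n → complexBetti A.X 1) :=
    basisOfLinearIndependentOfCardEqFinrank' 𝔣 h𝔣li hcard
  have h𝔣b : ∀ ls, 𝔣b ls = 𝔣 ls := fun ls => by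
    simp [𝔣b, coe_basisOfLinearIndependentOfCardEqFinrank']
  let 𝔅 : Module.Basis (Fin N × Fin n) ℂ (complexBetti B.X 1) := 𝔣b.map Φe
  have h𝔅 : ∀ l s, 𝔅 (l, s) = ∑ j : Fin n, ρ s ^ (j : ℕ) • complexBetti.map (π j).hom.hom.hom 1 (v l) := by
    intro l s
    rw [Module.Basis.map_apply, h𝔣b, hΦe]
    refine Finset.sum_congr rfl fun j _ => ?_
    rw [← hPapp, ← hPapp, ← map_smul]
  -- `X = diag ψ`
  let X : B ⟶ B := ∑ i, π i ≫ ψ ≫ ι i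
  have hXπ : ∀ k, X ≫ π k = π k ≫ ψ := by
    intro k
    simp only [X, Preadditive.sum_comp, Category.assoc, hιπ, comp_ite, Category.comp_id,
      Limits.comp_zero, Finset.sum_ite_eq', Finset.mem_univ, if_true]
  have hXpull : ∀ k x, complexBetti.map X.hom.hom.hom 1 (complexBetti.map (π k).hom.hom.hom 1 x) =
      complexBetti.map (π k).hom.hom.hom 1 (complexBetti.map ψ.hom.hom.hom 1 x) := by
    intro k x
    rw [complexBetti_map_map_one_apply, hXπ, ← complexBetti_map_map_one_apply]
  have hX𝔅 : ∀ l s, complexBetti.map X.hom.hom.hom 1 (𝔅 (l, s)) = μ l • 𝔅 (l, s) := by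
    intro l s
    rw [h𝔅, map_sum, Finset.smul_sum]
    refine Finset.sum_congr rfl fun j _ => ?_
    rw [map_smul, hXpull, hv, map_smul, smul_comm]
  -- `Y = θ` through the transposed companion matrix `T`
  let T : Fin n → Fin n → ℤ := fun i j =>
    if (i : ℕ) = (j : ℕ) + 1 then 1 else if (j : ℕ) = n - 1 then -(b i) else 0
  have hTval : ∀ j j' : Fin n, (T j j' : ℂ) =
      if (j : ℕ) = (j' : ℕ) + 1 then 1 else if (j' : ℕ) = n - 1 then -(b j : ℂ) else 0 := by
    intro j j'
    simp only [T]
    split_ifs <;> simp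
  have hT : ∀ (s : Fin n) (j' : Fin n), ∑ j : Fin n, (T j j' : ℂ) * ρ s ^ (j : ℕ) = ρ s ^ ((j' : ℕ) + 1) := by
    intro s j'
    simp_rw [hTval]
    by_cases hj' : (j' : ℕ) + 1 < n
    · rw [Finset.sum_eq_single ⟨(j' : ℕ) + 1, hj'⟩]
      · rw [if_pos (show ((⟨(j' : ℕ) + 1, hj'⟩ : Fin n) : ℕ) = (j' : ℕ) + 1 from rfl), one_mul]
      · intro j _ hj
        have h1 : ¬ ((j : ℕ) = (j' : ℕ) + 1) := fun h => hj (Fin.ext h)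
        have h2 : ¬ ((j' : ℕ) = n - 1) := by omega
        rw [if_neg h1, if_neg h2, zero_mul]
      · intro h
        exact absurd (Finset.mem_univ _) h
    · have hj'eq : (j' : ℕ) = n - 1 := by omega
      have hnn : (j' : ℕ) + 1 = n := by omega
      rw [hnn]
      have h := hfρ s
      rw [add_eq_zero_iff_eq_neg] at h
      rw [h, ← Finset.sum_neg_distrib]
      refine Finset.sum_congr rfl fun j _ => ?_
      have h1 : ¬ ((j : ℕ) = n) := by omega
      rw [if_neg h1, if_pos hj'eq]
      ring
  let Y : B ⟶ B := ∑ i, ∑ j, T i j • (π j ≫ ι i)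
  have hYπ : ∀ k, Y ≫ π k = ∑ j, T k j • π j := by
    intro k
    simp only [Y, Preadditive.sum_comp, Preadditive.zsmul_comp, Category.assoc, hιπ, comp_ite,
      Category.comp_id, Limits.comp_zero, smul_ite, smul_zero]
    rw [Finset.sum_comm]
    simp only [Finset.sum_ite_eq', Finset.mem_univ, if_true]
  have hYpull : ∀ k x, complexBetti.map Y.hom.hom.hom 1 (complexBetti.map (π k).hom.hom.hom 1 x) =
      ∑ j, (T k j : ℂ) • complexBetti.map (π j).hom.hom.hom 1 x := by
    intro k x
    rw [complexBetti_map_map_one_apply, hYπ, complexBetti_map_finsetSum_one]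
    change (∑ j, complexBetti.map (T k j • π j).hom.hom.hom 1).hom x = _
    rw [ModuleCat.hom_sum, LinearMap.coe_sum, Finset.sum_apply]
    refine Finset.sum_congr rfl fun j _ => ?_
    rw [complexBetti_map_zsmul_one, ModuleCat.hom_zsmul, LinearMap.smul_apply, Int.cast_smul_eq_zsmul]
  have hY𝔅 : ∀ l s, complexBetti.map Y.hom.hom.hom 1 (𝔅 (l, s)) = ρ s • 𝔅 (l, s) := by
    intro l s
    rw [h𝔅, map_sum]
    simp_rw [map_smul, hYpull, Finset.smul_sum, smul_smul]
    rw [Finset.sum_comm]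
    refine Finset.sum_congr rfl fun j _ => ?_
    rw [← Finset.sum_smul, ← pow_succ']
    congr 1
    rw [← hT s j]
    refine Finset.sum_congr rfl fun k _ => ?_
    ring
  -- `ι_0^* 𝔅(λ, s) = v_λ`
  have hι𝔅 : ∀ l s, complexBetti.map (ι ⟨0, hn⟩).hom.hom.hom 1 (𝔅 (l, s)) = v l := by
    intro l s
    rw [h𝔅]
    have hc := hcoord (fun j : Fin n => ρ s ^ (j : ℕ) • v l) ⟨0, hn⟩
    have e : (∑ j : Fin n, ρ s ^ (j : ℕ) • complexBetti.map (π j).hom.hom.hom 1 (v l)) =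
        ∑ j : Fin n, complexBetti.map (π j).hom.hom.hom 1 (ρ s ^ (j : ℕ) • v l) :=
      Finset.sum_congr rfl fun j _ => (map_smul _ _ _).symm
    rw [e, hc]
    simp
  -- `(Σ p_i π_i)^* v_λ = Σ_s 𝔅(λ, s)`
  have hπ𝔅 : ∀ l, complexBetti.map (∑ i : Fin n, p i • π i).hom.hom.hom 1 (v l) = ∑ s, 𝔅 (l, s) := by
    intro l
    rw [complexBetti_map_finsetSum_one]
    change (∑ i : Fin n, complexBetti.map (p i • π i).hom.hom.hom 1).hom (v l) = _
    rw [ModuleCat.hom_sum, LinearMap.coe_sum, Finset.sum_apply]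
    simp_rw [h𝔅]
    rw [Finset.sum_comm]
    refine Finset.sum_congr rfl fun j _ => ?_
    rw [← Finset.sum_smul, hp j, complexBetti_map_zsmul_one]
    change ((p j) • complexBetti.map (π j).hom.hom.hom 1).hom (v l) = _
    rw [ModuleCat.hom_zsmul, LinearMap.smul_apply, Int.cast_smul_eq_zsmul]
  -- `X` and `Y` commute: they act diagonally on the basis `𝔅` (faithfulness of `H¹`)
  have hXY : X ≫ Y = Y ≫ X := by
    apply AbelianVariety.hom_eq_of_complexBetti_map_one_eq
    rw [complexBetti_map_comp_hom, complexBetti_map_comp_hom]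
    ext1
    apply 𝔅.ext
    rintro ⟨l, s⟩
    simp only [ModuleCat.hom_comp, LinearMap.coe_comp, Function.comp_apply]
    change complexBetti.map X.hom.hom.hom 1 (complexBetti.map Y.hom.hom.hom 1 (𝔅 (l, s))) =
      complexBetti.map Y.hom.hom.hom 1 (complexBetti.map X.hom.hom.hom 1 (𝔅 (l, s)))
    rw [hY𝔅, map_smul, hX𝔅, map_smul, hY𝔅, smul_comm]
  exact ⟨X, Y, 𝔅, h𝔅, hX𝔅, hY𝔅, hι𝔅, hπ𝔅, hXY⟩

end Summit.HodgeConjecture.HodgeConjecture.Theorems.HodgeAbelianVarieties.CMPivotAndre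

end
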